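import Literature.NumberTheory.Automorphic.CompactCoreCentralizerBounded
import Literature.NumberTheory.Automorphic.CompactCoreCentralizerLevelOfIntegralConjugacy
import Literature.NumberTheory.Automorphic.AdicCompletionCompact
import Mathlib.NumberTheory.NumberField.Completion.FinitePlace
import HarnessLib

/-!
# The compact core of the centraliser of a regular semisimple element of `GL_N(E_w)` is a COMPACT OPEN subgroup
(Tits, *Reductive groups over local fields* (1979), §3.9 «`T(k)` has a unique maximal compact subgroup, which is open»; Platonov–Rapinchuk (1994), §3.3;
Rogawski (1990), §4.3 p. 43 «the Haar measures on the tori `G_γ` normalised …»; Kottwitz (1986), Prop. 7.1)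

Topic `NumberTheory/Automorphic`; namespace `Literature.NumberTheory.Automorphic`.  THEOREMS ONLY (no definition, no instance, no notation, no named fact, no
`sorry`).  Cell `pub/hodgecm-mathlib`, P3a road D-N6s gap **g0** «`CompactCoreCentralizerNonarch`» (LEAD F0P3a-plan (g8) T7-5 (1) 2026-09-01; A-p03 (g23)),
FILE B over ★ FILE A `CompactCoreCentralizerBounded` (the uniform coordinate bound `exists_forall_norm_coord_le` and `isCompact_compactCore_centralizer_of_isClosed`).
WHY (as dealt): the vol-one normalisation of ★ `OrbitalMeasureFamily.IsCanonical` (`OrbitalMeasureCanonical` :134) asks, at EVERY regular semisimple class and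
EVERY finite place `w`, for a Haar measure `t` on `G_γ` with `t (compactCore G_γ) = 1`, i.e. for `compactCore G_γ` to be compact, open, non-empty; ★
`CanonicalTorusMeasureTransport.map_eq_of_apply_compactCore_eq_one` carries `IsCompact (compactCore Z′)` ∕ `IsOpen (compactCore Z′)` as hypotheses; the tree had
them only at the places of good reduction of a RATIONAL `γ` (★ `CompactCoreCentralizerLevelOfIntegralConjugacy`: there `compactCore Z(γ_w) ⊆ GL_N(𝒪_w)`).  Here:

* §1 GENERIC (`Z` a topological group whose elements commute): `compactCore Z` is inverse-closed, closed under products (`mul_mem_compactCore`: `K_a · K_b` is a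
  compact subgroup), the carrier of a subgroup (`exists_subgroup_coe_eq_compactCore`), OPEN as soon as `Z` has ONE compact open subgroup
  (`isOpen_compactCore_of_subgroup`), hence closed; and a compact open compact core carries an inversion-invariant Haar measure of mass one
  (`exists_isHaarMeasure_compactCore_eq_one` — the `∃ t` conjunct of `IsCanonical`).
* §2 `Z = Z_{GL_N(E_w)}(γ)` for `γ ∈ GL_N(E_w)` with SEPARABLE characteristic polynomial (`E` a number field, `w` a finite place; NO rationality, NO good
  reduction): `Z` is commutative (★ `commute_of_commute_map_of_charpoly_separable`), `Z ∩ GL_N(𝒪_w)` is a compact open subgroup (★ `isCompact_glInt` ∕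
  `isOpen_glInt`), hence **`isOpen_compactCore_centralizer`**, `isClosed_compactCore_centralizer`, `exists_subgroup_coe_eq_compactCore_centralizer`, and —
  by FILE A at `F = E_w` (Mathlib `Valued.toNontriviallyNormedField`, ★ `properSpace_adicCompletion`) — **`isCompact_compactCore_centralizer`**; whence
  **`exists_isHaarMeasure_compactCore_centralizer_eq_one`**: a Haar measure on `Z(γ)`, inversion-invariant, with `t (compactCore Z(γ)) = 1`.
* §3 DOCKING (no re-proof): at the good-reduction data of ★ `subgroup_le_glInt_of_isCompact_of_le_centralizer` (rational `γ ⊗ 1`, `γ_w ∈ GL_N(𝒪_w)`,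
  separable reduction) the compact core IS the integral part: `compactCore_centralizer_eq_setOf_mem_glInt`.  The cofinite reading is ★
  `eventually_compactCore_centralizer_subset_of_charpoly_eq` (cited, not restated); the `U(J)(F_v)` reading is one line by ★ `image_compactCore` along
  ★ `localSplitEquiv` ∕ `localNonsplitEquiv` (consumer-side).
HONEST LABEL: structure theory of `T(F_v)` for the tori of `GL_N`; HC_CM is proved only modulo the printed citations until rung 0 closes; this file moves no count.

## Mathlib ∕ tree search
Tree: ★ FILE A; ★ `OrbitalMeasureCanonical` (`compactCore` API); ★ `ReductiveGroupData` (`glInt`, `isOpen_glInt`, `isCompact_glInt`); ★ `AdicCompletionCompact`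
(`properSpace_adicCompletion`, `locallyCompactSpace_adicCompletion`); ★ `CompactCoreCentralizerLevelOfIntegralConjugacy` (`subgroup_le_glInt_of_isCompact_of_le_centralizer`,
`exists_subgroup_coe_eq_mul_of_forall_commute`).  Mathlib: `Valued.toNontriviallyNormedField`, `instNormedFieldValuedAdicCompletion`, `haarMeasure_self`,
`IsHaarMeasure.isInvInvariant_of_regular`, `Subgroup.isClosed_of_isOpen`, `isOpenMap_mul_left`.  Dedup: `rg "compactCore_centralizer_eq|isCompact_compactCore" Literature/` — no hits.

## References
* [Tits1979] J. Tits, *Reductive groups over local fields*, Proc. Sympos. Pure Math. 33.1 (1979), §3.9.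
* [PlatonovRapinchuk1994] V. Platonov, A. Rapinchuk, *Algebraic Groups and Number Theory* (1994), §3.3.
* [Rogawski1990] J. D. Rogawski, *Automorphic Representations of Unitary Groups in Three Variables* (1990), §4.3 p. 43.
* [Kottwitz1986] R. E. Kottwitz, *Stable trace formula: elliptic singular terms*, Math. Ann. 275 (1986), Prop. 7.1.
-/

set_option autoImplicit false

noncomputable section

open MeasureTheory Measure Set Filter Topology Polynomial NumberField IsDedekindDomain
open scoped Pointwise ENNReal Matrix MatrixGroups

namespace Literature.NumberTheory.Automorphic

/-! ## §1 Generic: the compact core of a commutative topological group with a compact open subgroup -/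

section Generic

variable {Z : Type*} [Group Z] [TopologicalSpace Z] [IsTopologicalGroup Z]

omit [IsTopologicalGroup Z] in
/-- The compact core is closed under inversion (any topological group). [cite: Tits1979, §3.9] -/
theorem inv_mem_compactCore {z : Z} (hz : z ∈ compactCore Z) : z⁻¹ ∈ compactCore Z := by
  obtain ⟨K, hK, hzK⟩ := (mem_compactCore_iff z).1 hz
  exact (mem_compactCore_iff _).2 ⟨K, hK, K.inv_mem hzK⟩

omit [IsTopologicalGroup Z] in
/-- `z⁻¹ ∈ compactCore Z ↔ z ∈ compactCore Z`. [cite: Tits1979, §3.9] -/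
theorem inv_mem_compactCore_iff (z : Z) : z⁻¹ ∈ compactCore Z ↔ z ∈ compactCore Z :=
  ⟨fun h => inv_inv z ▸ inv_mem_compactCore h, inv_mem_compactCore⟩

omit [TopologicalSpace Z] [IsTopologicalGroup Z] in
/-- In a commutative group the product set `C · K′` of two subgroups is a subgroup. [cite: PlatonovRapinchuk1994, §3.3] -/
theorem exists_subgroup_coe_eq_mul_of_comm (hcomm : ∀ a b : Z, a * b = b * a) (C K' : Subgroup Z) :
    ∃ D : Subgroup Z, (D : Set Z) = (C : Set Z) * (K' : Set Z) := by
  refine ⟨{ carrier := (C : Set Z) * (K' : Set Z), mul_mem' := ?_, one_mem' := ⟨1, C.one_mem, 1, K'.one_mem, mul_one 1⟩, inv_mem' := ?_ }, rfl⟩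
  · rintro _ _ ⟨a, ha, b, hb, rfl⟩ ⟨a', ha', b', hb', rfl⟩
    refine ⟨a * a', C.mul_mem ha ha', b * b', K'.mul_mem hb hb', ?_⟩
    calc a * a' * (b * b') = a * (a' * b) * b' := by simp only [mul_assoc]
      _ = a * (b * a') * b' := by rw [hcomm a' b]
      _ = a * b * (a' * b') := by simp only [mul_assoc]
  · rintro _ ⟨a, ha, b, hb, rfl⟩
    refine ⟨a⁻¹, C.inv_mem ha, b⁻¹, K'.inv_mem hb, ?_⟩
    rw [mul_inv_rev, hcomm]

/-- **The compact core of a commutative topological group is closed under products**: `K_a · K_b` is a compact subgroup containing `a b`. [cite: Tits1979, §3.9] [cite: PlatonovRapinchuk1994, §3.3] -/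
theorem mul_mem_compactCore (hcomm : ∀ a b : Z, a * b = b * a) {a b : Z} (ha : a ∈ compactCore Z)
    (hb : b ∈ compactCore Z) : a * b ∈ compactCore Z := by
  obtain ⟨Ka, hKa, haK⟩ := (mem_compactCore_iff a).1 ha
  obtain ⟨Kb, hKb, hbK⟩ := (mem_compactCore_iff b).1 hb
  obtain ⟨D, hD⟩ := exists_subgroup_coe_eq_mul_of_comm hcomm Ka Kb
  refine (mem_compactCore_iff _).2 ⟨D, ?_, ?_⟩
  · rw [hD]; exact hKa.mul hKb
  · rw [← SetLike.mem_coe, hD]; exact ⟨a, haK, b, hbK, rfl⟩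

/-- **The compact core of a commutative topological group is (the carrier of) a subgroup.** [cite: Tits1979, §3.9] [cite: PlatonovRapinchuk1994, §3.3] -/
theorem exists_subgroup_coe_eq_compactCore (hcomm : ∀ a b : Z, a * b = b * a) :
    ∃ C : Subgroup Z, (C : Set Z) = compactCore Z :=
  ⟨{ carrier := compactCore Z, mul_mem' := fun ha hb => mul_mem_compactCore hcomm ha hb, one_mem' := one_mem_compactCore,
     inv_mem' := fun h => inv_mem_compactCore h }, rfl⟩

/-- **The compact core is OPEN** as soon as the commutative group has one compact open subgroup `K₀` (`z · K₀ ⊆ K_z · K₀ ⊆ compactCore`). [cite: Tits1979, §3.9] [cite: PlatonovRapinchuk1994, §3.3] -/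
theorem isOpen_compactCore_of_subgroup (hcomm : ∀ a b : Z, a * b = b * a) (K₀ : Subgroup Z) (hc : IsCompact (K₀ : Set Z))
    (ho : IsOpen (K₀ : Set Z)) : IsOpen (compactCore Z) := by
  rw [isOpen_iff_forall_mem_open]
  intro z hz
  refine ⟨(fun k => z * k) '' (K₀ : Set Z), ?_, isOpenMap_mul_left z _ ho, ⟨1, K₀.one_mem, mul_one z⟩⟩
  rintro _ ⟨k, hk, rfl⟩
  exact mul_mem_compactCore hcomm hz (subset_compactCore_of_isCompact hc hk)

/-- … hence CLOSED (an open subgroup is closed). [cite: Tits1979, §3.9] -/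
theorem isClosed_compactCore_of_subgroup (hcomm : ∀ a b : Z, a * b = b * a) (K₀ : Subgroup Z) (hc : IsCompact (K₀ : Set Z))
    (ho : IsOpen (K₀ : Set Z)) : IsClosed (compactCore Z) := by
  obtain ⟨C, hC⟩ := exists_subgroup_coe_eq_compactCore hcomm
  rw [← hC]
  exact C.isClosed_of_isOpen (hC ▸ isOpen_compactCore_of_subgroup hcomm K₀ hc ho)

omit [IsTopologicalGroup Z] in
/-- The compact core is non-empty. [cite: Tits1979, §3.9] -/
theorem compactCore_nonempty : (compactCore Z).Nonempty := ⟨1, one_mem_compactCore⟩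

/-- **A compact open compact core carries the normalised Haar measure**: on a commutative locally compact group whose compact core is compact and open there is a Haar measure `t`, inversion-invariant, with `t (compactCore Z) = 1` — the `∃ t` conjunct of ★ `OrbitalMeasureFamily.IsCanonical` (Mathlib `haarMeasure_self`, `IsHaarMeasure.isInvInvariant_of_regular`). [cite: Rogawski1990, §4.3 p. 43] [cite: Tits1979, §3.9] -/
theorem exists_isHaarMeasure_compactCore_eq_one [LocallyCompactSpace Z] [MeasurableSpace Z] [BorelSpace Z]
    (hcomm : ∀ a b : Z, a * b = b * a) (hc : IsCompact (compactCore Z)) (ho : IsOpen (compactCore Z)) :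
    ∃ t : Measure Z, t.IsHaarMeasure ∧ t.IsInvInvariant ∧ t (compactCore Z) = 1 := by
  let K₀ : TopologicalSpace.PositiveCompacts Z := ⟨⟨compactCore Z, hc⟩, by rw [ho.interior_eq]; exact compactCore_nonempty⟩
  refine ⟨haarMeasure K₀, inferInstance, ?_, haarMeasure_self⟩
  letI : CommGroup Z := { (inferInstance : Group Z) with mul_comm := hcomm }
  infer_instance

end Generic

/-! ## §2 The centraliser of a regular semisimple element of `GL_N(E_w)` -/

section LocalGL

variable {E : Type} [Field E] [NumberField E] (w : HeightOneSpectrum (𝓞 E)) {N : ℕ}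
  (γ : GL (Fin N) (w.adicCompletion E))

/-- **The centraliser of a regular semisimple `γ ∈ GL_N(E_w)` is commutative** (★ `commute_of_commute_map_of_charpoly_separable` at `K = R = E_w`). [cite: HornJohnson2013, Thm. 3.2.4.2] [cite: Tits1979, §3.9] -/
theorem mul_comm_of_mem_centralizer_of_charpoly_separable
    (hγ : ((γ : Matrix (Fin N) (Fin N) (w.adicCompletion E)).charpoly).Separable)
    (a b : Subgroup.centralizer ({γ} : Set (GL (Fin N) (w.adicCompletion E)))) : a * b = b * a := by
  obtain ⟨a, ha⟩ := a
  obtain ⟨b, hb⟩ := b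
  rw [Subgroup.mem_centralizer_singleton_iff] at ha hb
  apply Subtype.ext
  apply Units.ext
  have ha' : Commute ((γ : Matrix (Fin N) (Fin N) (w.adicCompletion E)).map
      (algebraMap (w.adicCompletion E) (w.adicCompletion E))) (a : Matrix (Fin N) (Fin N) (w.adicCompletion E)) := by
    have h := congrArg (fun u : GL (Fin N) (w.adicCompletion E) => (u : Matrix (Fin N) (Fin N) (w.adicCompletion E))) ha
    simp only [Units.val_mul] at h
    rw [Algebra.algebraMap_self, RingHom.coe_id, Matrix.map_id]
    exact h.symm
  have hb' : Commute ((γ : Matrix (Fin N) (Fin N) (w.adicCompletion E)).map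
      (algebraMap (w.adicCompletion E) (w.adicCompletion E))) (b : Matrix (Fin N) (Fin N) (w.adicCompletion E)) := by
    have h := congrArg (fun u : GL (Fin N) (w.adicCompletion E) => (u : Matrix (Fin N) (Fin N) (w.adicCompletion E))) hb
    simp only [Units.val_mul] at h
    rw [Algebra.algebraMap_self, RingHom.coe_id, Matrix.map_id]
    exact h.symm
  exact (Literature.LinearAlgebra.Matrix.commute_of_commute_map_of_charpoly_separable
    (K := w.adicCompletion E) (R := w.adicCompletion E) _ hγ ha' hb').eq

/-- `Z(γ) ∩ GL_N(𝒪_w)` is compact in `Z(γ)` (★ `isCompact_glInt`; `Z(γ)` closed). [cite: PlatonovRapinchuk1994, §3.3] [cite: Tits1979, §3.9] -/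
theorem isCompact_coe_glInt_subgroupOf_centralizer :
    IsCompact (((glInt N (w.adicCompletion E)).subgroupOf (Subgroup.centralizer ({γ} : Set (GL (Fin N) (w.adicCompletion E)))) :
      Set (Subgroup.centralizer ({γ} : Set (GL (Fin N) (w.adicCompletion E)))))) := by
  rw [Subgroup.coe_subgroupOf]
  exact (Set.isClosed_centralizer _).isClosedEmbedding_subtypeVal.isCompact_preimage (isCompact_glInt N (w.adicCompletion E))

/-- `Z(γ) ∩ GL_N(𝒪_w)` is open in `Z(γ)` (★ `isOpen_glInt`). [cite: PlatonovRapinchuk1994, §3.3] -/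
theorem isOpen_coe_glInt_subgroupOf_centralizer :
    IsOpen (((glInt N (w.adicCompletion E)).subgroupOf (Subgroup.centralizer ({γ} : Set (GL (Fin N) (w.adicCompletion E)))) :
      Set (Subgroup.centralizer ({γ} : Set (GL (Fin N) (w.adicCompletion E)))))) := by
  rw [Subgroup.coe_subgroupOf]
  exact (isOpen_glInt N (w.adicCompletion E)).preimage continuous_subtype_val


/-- **The compact core of `Z(γ)` is OPEN** (`γ` regular semisimple; §1 with the compact open subgroup `Z(γ) ∩ GL_N(𝒪_w)`). [cite: Tits1979, §3.9] [cite: PlatonovRapinchuk1994, §3.3] -/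
theorem isOpen_compactCore_centralizer (hγ : ((γ : Matrix (Fin N) (Fin N) (w.adicCompletion E)).charpoly).Separable) :
    IsOpen (compactCore (Subgroup.centralizer ({γ} : Set (GL (Fin N) (w.adicCompletion E))))) :=
  isOpen_compactCore_of_subgroup (mul_comm_of_mem_centralizer_of_charpoly_separable w γ hγ) _
    (isCompact_coe_glInt_subgroupOf_centralizer w γ) (isOpen_coe_glInt_subgroupOf_centralizer w γ)

/-- **… and CLOSED.** [cite: Tits1979, §3.9] -/
theorem isClosed_compactCore_centralizer (hγ : ((γ : Matrix (Fin N) (Fin N) (w.adicCompletion E)).charpoly).Separable) :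
    IsClosed (compactCore (Subgroup.centralizer ({γ} : Set (GL (Fin N) (w.adicCompletion E))))) :=
  isClosed_compactCore_of_subgroup (mul_comm_of_mem_centralizer_of_charpoly_separable w γ hγ) _
    (isCompact_coe_glInt_subgroupOf_centralizer w γ) (isOpen_coe_glInt_subgroupOf_centralizer w γ)

/-- **… and the carrier of a subgroup of `Z(γ)`.** [cite: Tits1979, §3.9] [cite: PlatonovRapinchuk1994, §3.3] -/
theorem exists_subgroup_coe_eq_compactCore_centralizer (hγ : ((γ : Matrix (Fin N) (Fin N) (w.adicCompletion E)).charpoly).Separable) :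
    ∃ C : Subgroup (Subgroup.centralizer ({γ} : Set (GL (Fin N) (w.adicCompletion E)))),
      (C : Set (Subgroup.centralizer ({γ} : Set (GL (Fin N) (w.adicCompletion E))))) =
        compactCore (Subgroup.centralizer ({γ} : Set (GL (Fin N) (w.adicCompletion E)))) :=
  exists_subgroup_coe_eq_compactCore (mul_comm_of_mem_centralizer_of_charpoly_separable w γ hγ)

/-- The integral part lies in the compact core: `Z(γ) ∩ GL_N(𝒪_w) ⊆ compactCore Z(γ)` (any `γ`). [cite: PlatonovRapinchuk1994, §3.3] -/
theorem coe_glInt_subgroupOf_centralizer_subset_compactCore :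
    (((glInt N (w.adicCompletion E)).subgroupOf (Subgroup.centralizer ({γ} : Set (GL (Fin N) (w.adicCompletion E))))) :
      Set (Subgroup.centralizer ({γ} : Set (GL (Fin N) (w.adicCompletion E))))) ⊆
      compactCore (Subgroup.centralizer ({γ} : Set (GL (Fin N) (w.adicCompletion E)))) :=
  subset_compactCore_of_isCompact (isCompact_coe_glInt_subgroupOf_centralizer w γ)

/-- **THE COMPACT CORE OF THE CENTRALISER OF A REGULAR SEMISIMPLE `γ ∈ GL_N(E_w)` IS COMPACT** — the maximal compact subgroup of the torus
`Z(γ) = E_w[γ]ˣ` (★ FILE A `isCompact_compactCore_centralizer_of_isClosed` at `F = E_w`, read as a complete ultrametric proper non-trivially normed field via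
Mathlib `Valued.toNontriviallyNormedField` + ★ `properSpace_adicCompletion`, and `isClosed_compactCore_centralizer`). [cite: Tits1979, §3.9] [cite: PlatonovRapinchuk1994, §3.3] -/
theorem isCompact_compactCore_centralizer (hγ : ((γ : Matrix (Fin N) (Fin N) (w.adicCompletion E)).charpoly).Separable) :
    IsCompact (compactCore (Subgroup.centralizer ({γ} : Set (GL (Fin N) (w.adicCompletion E))))) := by
  letI : NontriviallyNormedField (w.adicCompletion E) :=
    Valued.toNontriviallyNormedField (w.adicCompletion E) (WithZero (Multiplicative ℤ))
  haveI : ProperSpace (w.adicCompletion E) := properSpace_adicCompletion E w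
  exact isCompact_compactCore_centralizer_of_isClosed γ hγ (isClosed_compactCore_centralizer w γ hγ)

/-- `Z(γ)` is locally compact (closed in the locally compact `GL_N(E_w)`). [cite: PlatonovRapinchuk1994, §3.3] -/
theorem locallyCompactSpace_centralizer :
    LocallyCompactSpace (Subgroup.centralizer ({γ} : Set (GL (Fin N) (w.adicCompletion E)))) := by
  haveI := locallyCompactSpace_adicCompletion E w
  haveI : LocallyCompactSpace (Matrix (Fin N) (Fin N) (w.adicCompletion E)) :=
    inferInstanceAs (LocallyCompactSpace (Fin N → Fin N → w.adicCompletion E))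
  haveI : LocallyCompactSpace (Matrix (Fin N) (Fin N) (w.adicCompletion E))ᵐᵒᵖ :=
    MulOpposite.opHomeomorph.symm.isClosedEmbedding.locallyCompactSpace
  haveI : LocallyCompactSpace (GL (Fin N) (w.adicCompletion E)) := Units.isClosedEmbedding_embedProduct.locallyCompactSpace
  exact (Set.isClosed_centralizer _).isClosedEmbedding_subtypeVal.locallyCompactSpace

/-- **THE NORMALISED TORUS MEASURE EXISTS at every regular semisimple class and every finite place**: a Haar measure `t` on `Z(γ)`,
inversion-invariant, with `t (compactCore Z(γ)) = 1` — the `∃ t` conjunct of ★ `OrbitalMeasureFamily.IsCanonical` (:134), with NO good-reduction or rationality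
hypothesis. [cite: Rogawski1990, §4.3 p. 43] [cite: Tits1979, §3.9] -/
theorem exists_isHaarMeasure_compactCore_centralizer_eq_one (hγ : ((γ : Matrix (Fin N) (Fin N) (w.adicCompletion E)).charpoly).Separable)
    [MeasurableSpace (Subgroup.centralizer ({γ} : Set (GL (Fin N) (w.adicCompletion E))))]
    [BorelSpace (Subgroup.centralizer ({γ} : Set (GL (Fin N) (w.adicCompletion E))))] :
    ∃ t : Measure (Subgroup.centralizer ({γ} : Set (GL (Fin N) (w.adicCompletion E)))),
      t.IsHaarMeasure ∧ t.IsInvInvariant ∧ t (compactCore (Subgroup.centralizer ({γ} : Set (GL (Fin N) (w.adicCompletion E))))) = 1 := by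
  haveI := locallyCompactSpace_centralizer w γ
  exact exists_isHaarMeasure_compactCore_eq_one (mul_comm_of_mem_centralizer_of_charpoly_separable w γ hγ)
    (isCompact_compactCore_centralizer w γ hγ) (isOpen_compactCore_centralizer w γ hγ)

end LocalGL

/-! ## §3 Docking with the good-reduction case (★ `CompactCoreCentralizerLevelOfIntegralConjugacy`) -/

section Docking

variable {E : Type} [Field E] [NumberField E] {N : ℕ} (w : HeightOneSpectrum (𝓞 E)) (γ : GL (Fin N) E)

/-- **At a place of good reduction the compact core IS the integral part**: for a RATIONAL `γ ∈ GL_N(E)` with separable characteristic polynomial,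
`γ_w ∈ GL_N(𝒪_w)` and separable reduction (the hypotheses of ★ `subgroup_le_glInt_of_isCompact_of_le_centralizer`, verbatim),
`compactCore Z(γ ⊗ 1) = Z(γ ⊗ 1) ∩ GL_N(𝒪_w)` — `⊆` by that ★ lemma applied to the compact subgroup through a point of the core, `⊇` by §2.  The cofinite form
«for almost every `w`» is ★ `eventually_compactCore_centralizer_subset_of_charpoly_eq`. [cite: Kottwitz1986, Prop. 7.1] [cite: Tits1979, §3.9] -/
theorem compactCore_centralizer_eq_setOf_mem_glInt
    (hγ : ((γ : Matrix (Fin N) (Fin N) E).charpoly).Separable)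
    (hγint : Matrix.GeneralLinearGroup.map (algebraMap E (w.adicCompletion E)) γ ∈ glInt N (w.adicCompletion E))
    (hsep : ∃ q : (w.adicCompletionIntegers E)[X],
      q.map (w.adicCompletionIntegers E).subtype = (γ : Matrix (Fin N) (Fin N) E).charpoly.map (algebraMap E (w.adicCompletion E)) ∧
        (q.map (IsLocalRing.residue (w.adicCompletionIntegers E))).Separable) :
    compactCore (Subgroup.centralizer
        ({Matrix.GeneralLinearGroup.map (algebraMap E (w.adicCompletion E)) γ} : Set (GL (Fin N) (w.adicCompletion E)))) =
      {z : Subgroup.centralizer ({Matrix.GeneralLinearGroup.map (algebraMap E (w.adicCompletion E)) γ} :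
          Set (GL (Fin N) (w.adicCompletion E))) | (z : GL (Fin N) (w.adicCompletion E)) ∈ glInt N (w.adicCompletion E)} := by
  refine Set.Subset.antisymm (fun z hz => ?_) (fun z hz => ?_)
  · obtain ⟨K, hK, hzK⟩ := (mem_compactCore_iff z).1 hz
    have hle := subgroup_le_glInt_of_isCompact_of_le_centralizer N w γ hγ hγint hsep
      (K.map (Subgroup.centralizer ({Matrix.GeneralLinearGroup.map (algebraMap E (w.adicCompletion E)) γ} :
        Set (GL (Fin N) (w.adicCompletion E)))).subtype)
      (by rw [Subgroup.coe_map]; exact hK.image continuous_subtype_val)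
      (by rw [Subgroup.map_le_iff_le_comap]; intro u _; exact u.2)
    exact hle ⟨z, hzK, rfl⟩
  · exact coe_glInt_subgroupOf_centralizer_subset_compactCore w _ (by rw [Subgroup.coe_subgroupOf]; exact hz)

end Docking

end Literature.NumberTheory.Automorphic

end
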